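import Mathlib.Data.ZMod.Basic
import Mathlib.Data.Fintype.Sum
import Mathlib.Data.Fintype.Prod
import Mathlib.Data.Fintype.Sigma
import Mathlib.Tactic.FinCases
import Literature.Combinatorics.SimpleGraph.HamiltonianSatGadget
import HarnessLib

/-!
# A parity-system → directed Hamiltonian cycle gadget construction, I: the digraph

Support for the discharge of the named fact
`Literature.ModelTheory.FiniteModelTheory.AtseriasDawarOchremiak2021_hamiltonicity_countingWidth`
(linear counting width of Hamiltonicity; Atserias–Dawar–Ochremiak 2021, Lemma 14 of arXiv:1901.07825).
The printed proof of that lemma reduces 3-XOR/3-SAT to Hamiltonicity by "a minor modification of the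
textbook reduction … in Papadimitriou, Fig. 9.7 … Instead of aligning the variable gadgets in the form of a
path, we arrange them in the form of a big clique" and appeals to closure of `C^k` under quantifier-free
interpretations. For the formal proof we need a reduction from SYSTEMS OF PARITY CONSTRAINTS over `𝔽₂`
(scopes `vr u : Fin 3 → Fin n`, right-hand sides `b u`, constraint `∑ᵢ x_{vr u i} = b u`) to digraphs
that is EQUIVARIANT UNDER FLIPPING A VARIABLE (the Cai–Fürer–Immerman mechanism: flipping `x_v` must be a
digraph isomorphism onto the digraph of the system with the right-hand sides of the constraints containing
`v` complemented). This file defines such a digraph `Arc vr b` on the vertex type `Vtx n m`; its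
correctness ("Hamiltonian ⇒ `b` is in the column space", and an explicit Hamiltonian cycle for `b = 0`)
and its symmetry are proved in the sequel files. The design (ours; the chains-with-separators are those of
the tree's `HamiltonianSatGadget.lean` = Arora–Barak Thm 2.17 / Sipser Thm 7.46, the constraint device is
new) is:

* for every variable `v` TWO CHAINS `K(v,a)`, `a ∈ 𝔽₂`, each the concatenation, in reading order, of
  six-vertex SEGMENTS `nd a o 0 … nd a o 5` (= `λ α p q β ρ`) for the occurrence slots `o = (u, i, c)` of
  `v` (`vr u i = v`; two slots `c ∈ Fin 2` per occurrence), framed by a head `hd v a` and a tail `tl v a`;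
  connectors `cx 0, …, cx n` with `cx v → hd v a → cx (v+1)` for both `a`, and `tl v 0 ⇄ tl v 1`: a
  Hamiltonian cycle enters exactly one head `hd v (y v)` from `cx v`, and the other chain is then
  traversed right-to-left, which kills its LINKS `p → · → q`;
* for every constraint `u` a PARITY BLOCK on `bx u ℓ s` (`ℓ ∈ Fin 4`, track `s ∈ 𝔽₂`) and
  `bm u i t t'` (`i ∈ Fin 3`): `ce u → bx u 0 0`, `bx u i s → bm u i s t' → bx u (i+1) t'`,
  `bx u 3 (b u) → bx u 0 1`, `bx u 3 (b u + 1) → ce (u+1)`, and links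
  `nd a (u,i,c) 2 → bm u i t (t+1+a) → nd a (u,i,c) 3`: the middle vertex `bm u i t (t + y)` can only be
  entered from `bx u i t` when the chain `K(vr u i, y+1)` is dead, so both tracks switch by `y (vr u i)`
  at step `i`, and the two passes `bx u 0 0 ↦ bx u 3 (∑ y)` / `bx u 0 1 ↦ bx u 3 (1 + ∑ y)` close up
  wrongly (a 7-cycle) unless `∑ᵢ y (vr u i) = b u`;
* the spine `cx n → ce 0`, `ce m → cx 0`.

Flipping `v` swaps the two chains of `v` position-wise and translates the tracks of the blocks of the
constraints containing `v` by prefix sums — an isomorphism onto the digraph of the complemented system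
(file `…Flip`).

## References

* A. Atserias, A. Dawar, J. Ochremiak, *On the power of symmetric linear programs*, J. ACM 68 (2021),
  arXiv:1901.07825, §5.2, Lemma 14 (the statement this construction serves; the printed reduction is
  only sketched).
* S. Arora, B. Barak, *Computational Complexity*, CUP 2009, Thm 2.17; M. Sipser, *Introduction to the
  Theory of Computation*, 3rd ed., Thm 7.46 (chains with separator vertices; the tree's
  `HamiltonianSatGadget.lean`).
* J.-Y. Cai, M. Fürer, N. Immerman, Combinatorica 12 (1992), §6 (twisting a parity gadget).
-/

namespace Literature.Combinatorics.SimpleGraph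

namespace XorHam

/-! ### Occurrence slots and their reading order -/

/-- Occurrence slots of a system with `m` constraints of arity `3`: constraint, position, and link copy
(`c ∈ Fin 2`: every occurrence carries two links). [folklore] -/
abbrev Occ (m : ℕ) : Type := Fin m × Fin 3 × Fin 2

variable {n m : ℕ}

/-- The reading order of occurrence slots: `(u, i, c) ↦ 6u + 2i + c`. [folklore] -/
def flat (o : Occ m) : ℕ := 6 * (o.1 : ℕ) + 2 * (o.2.1 : ℕ) + (o.2.2 : ℕ)

/-- `flat` is injective. [folklore] -/
theorem flat_injective : Function.Injective (flat (m := m)) := by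
  rintro ⟨u, i, c⟩ ⟨u', i', c'⟩ h
  simp only [flat] at h
  have hi := i.2; have hi' := i'.2; have hc := c.2; have hc' := c'.2
  have hu : (u : ℕ) = u' := by omega
  have hii : (i : ℕ) = i' := by omega
  have hcc : (c : ℕ) = c' := by omega
  exact Prod.ext (Fin.ext hu) (Prod.ext (Fin.ext hii) (Fin.ext hcc))

/-- `flat o = flat o' ↔ o = o'`. [folklore] -/
theorem flat_inj {o o' : Occ m} : flat o = flat o' ↔ o = o' := flat_injective.eq_iff

variable (vr : Fin m → Fin 3 → Fin n)

/-- The variable of an occurrence slot. [folklore] -/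
def var (o : Occ m) : Fin n := vr o.1 o.2.1

/-- `o` is the first slot of its variable. [folklore] -/
def IsFirst (o : Occ m) : Prop := ∀ o' : Occ m, var vr o' = var vr o → flat o ≤ flat o'

/-- `o` is the last slot of its variable. [folklore] -/
def IsLast (o : Occ m) : Prop := ∀ o' : Occ m, var vr o' = var vr o → flat o' ≤ flat o

/-- `o'` is the next slot of the variable of `o`. [folklore] -/
def IsNextOcc (o o' : Occ m) : Prop :=
  var vr o' = var vr o ∧ flat o < flat o' ∧
    ∀ o'' : Occ m, var vr o'' = var vr o → flat o < flat o'' → flat o' ≤ flat o''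

/-- The variable `v` occurs in the system. [folklore] -/
def Occurs (v : Fin n) : Prop := ∃ o : Occ m, var vr o = v

/-! ### Vertices and arcs -/

/-- The vertices of the gadget digraph of a system with `n` variables and `m` constraints: connectors
`cx j` (`j ≤ n`) and `ce j` (`j ≤ m`); chain heads `hd v a` and tails `tl v a` (`a ∈ 𝔽₂` the copy);
segment vertices `nd a o s` (`s = 0,…,5` for `λ, α, p, q, β, ρ`); block vertices `bx u ℓ s`
(level `ℓ ∈ Fin 4`, track `s`) and `bm u i t t'` (switch `i`, from track `t` to track `t'`). [folklore] -/
inductive Vtx (n m : ℕ) : Type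
  | cx (j : Fin (n + 1))
  | ce (j : Fin (m + 1))
  | hd (v : Fin n) (a : ZMod 2)
  | tl (v : Fin n) (a : ZMod 2)
  | nd (a : ZMod 2) (o : Occ m) (s : Fin 6)
  | bx (u : Fin m) (ℓ : Fin 4) (s : ZMod 2)
  | bm (u : Fin m) (i : Fin 3) (t t' : ZMod 2)
  deriving DecidableEq

namespace Vtx

/-- The sum type used to enumerate the vertices. [folklore] -/
abbrev Code (n m : ℕ) : Type :=
  Fin (n + 1) ⊕ Fin (m + 1) ⊕ (Fin n × ZMod 2) ⊕ (Fin n × ZMod 2) ⊕ (ZMod 2 × Occ m × Fin 6) ⊕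
    (Fin m × Fin 4 × ZMod 2) ⊕ (Fin m × Fin 3 × ZMod 2 × ZMod 2)

/-- Encoding of vertices. [folklore] -/
def toCode : Vtx n m → Code n m
  | cx j => Sum.inl j
  | ce j => Sum.inr (Sum.inl j)
  | hd v a => Sum.inr (Sum.inr (Sum.inl (v, a)))
  | tl v a => Sum.inr (Sum.inr (Sum.inr (Sum.inl (v, a))))
  | nd a o s => Sum.inr (Sum.inr (Sum.inr (Sum.inr (Sum.inl (a, o, s)))))
  | bx u ℓ s => Sum.inr (Sum.inr (Sum.inr (Sum.inr (Sum.inr (Sum.inl (u, ℓ, s))))))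
  | bm u i t t' => Sum.inr (Sum.inr (Sum.inr (Sum.inr (Sum.inr (Sum.inr (u, i, t, t'))))))

/-- Decoding of vertices. [folklore] -/
def ofCode : Code n m → Vtx n m
  | Sum.inl j => cx j
  | Sum.inr (Sum.inl j) => ce j
  | Sum.inr (Sum.inr (Sum.inl (v, a))) => hd v a
  | Sum.inr (Sum.inr (Sum.inr (Sum.inl (v, a)))) => tl v a
  | Sum.inr (Sum.inr (Sum.inr (Sum.inr (Sum.inl (a, o, s))))) => nd a o s
  | Sum.inr (Sum.inr (Sum.inr (Sum.inr (Sum.inr (Sum.inl (u, ℓ, s)))))) => bx u ℓ s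
  | Sum.inr (Sum.inr (Sum.inr (Sum.inr (Sum.inr (Sum.inr (u, i, t, t')))))) => bm u i t t'

/-- The vertices are in bijection with the code type. [folklore] -/
def equivCode : Vtx n m ≃ Code n m where
  toFun := toCode
  invFun := ofCode
  left_inv x := by cases x <;> rfl
  right_inv c := by rcases c with j | j | ⟨v, a⟩ | ⟨v, a⟩ | ⟨a, o, s⟩ | ⟨u, ℓ, s⟩ | ⟨u, i, t, t'⟩ <;> rfl

/-- The vertices form a finite type. [folklore] -/
instance instFintype : Fintype (Vtx n m) :=
  Fintype.ofEquiv _ equivCode.symm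

/-- **Vertex count**: `(n+1) + (m+1) + 4n + 72m + 8m + 12m = 5n + 93m + 2`. [folklore] -/
theorem card_vtx (n m : ℕ) : Fintype.card (Vtx n m) = 5 * n + 93 * m + 2 := by
  rw [Fintype.card_congr (equivCode (n := n) (m := m))]
  simp only [Code, Fintype.card_sum, Fintype.card_prod, Fintype.card_fin, ZMod.card, Occ]
  ring

end Vtx

open Vtx

/-- **The arcs of the gadget digraph** of the system `(vr, b)` (module docstring). [folklore] -/
def Arc (b : Fin m → ZMod 2) : Vtx n m → Vtx n m → Prop
  -- spine
  | cx j, hd v _ => j = v.castSucc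
  | hd v _, cx j => j = v.succ
  | cx j, ce j' => j = Fin.last n ∧ j' = 0
  | ce j, cx j' => j = Fin.last m ∧ j' = 0
  | ce j, bx u ℓ s => j = u.castSucc ∧ ℓ = 0 ∧ s = 0
  | bx u ℓ s, ce j => ℓ = 3 ∧ s = b u + 1 ∧ j = u.succ
  -- chains
  | hd v a, nd a' o s => a = a' ∧ s = 0 ∧ var vr o = v ∧ IsFirst vr o
  | nd a' o s, hd v a => a = a' ∧ s = 0 ∧ var vr o = v ∧ IsFirst vr o
  | hd v a, tl v' a' => v = v' ∧ a = a' ∧ ¬ Occurs vr v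
  | tl v' a', hd v a => v = v' ∧ a = a' ∧ ¬ Occurs vr v
  | nd a o s, tl v a' => a = a' ∧ s = 5 ∧ var vr o = v ∧ IsLast vr o
  | tl v a', nd a o s => a = a' ∧ s = 5 ∧ var vr o = v ∧ IsLast vr o
  | tl v a, tl v' a' => v = v' ∧ a ≠ a'
  | nd a o s, nd a' o' s' => a = a' ∧
      ((o = o' ∧ ((s : ℕ) + 1 = s' ∨ (s' : ℕ) + 1 = s)) ∨
        (s = 5 ∧ s' = 0 ∧ IsNextOcc vr o o') ∨ (s = 0 ∧ s' = 5 ∧ IsNextOcc vr o' o))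
  -- links
  | nd a o s, bm u i t t' => s = 2 ∧ o.1 = u ∧ o.2.1 = i ∧ t' = t + 1 + a
  | bm u i t t', nd a o s => s = 3 ∧ o.1 = u ∧ o.2.1 = i ∧ t' = t + 1 + a
  -- blocks
  | bx u ℓ s, bm u' i t _ => u = u' ∧ ℓ = i.castSucc ∧ s = t
  | bm u' i _ t', bx u ℓ s => u = u' ∧ ℓ = i.succ ∧ s = t'
  | bx u ℓ s, bx u' ℓ' s' => u = u' ∧ ℓ = 3 ∧ s = b u ∧ ℓ' = 0 ∧ s' = 1
  | _, _ => False

/-! ### Neighbourhoods -/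

section Nbhd

variable {vr} {b : Fin m → ZMod 2}

/-- Values in `Fin 6` are determined by their underlying naturals. [folklore] -/
theorem fin6_eq_of_val {s : Fin 6} {k : ℕ} (hk : k < 6) (h : (s : ℕ) = k) : s = ⟨k, hk⟩ := Fin.ext h

/-- The underlying naturals of the six positions. [folklore] -/
theorem val_fin6 : ((0 : Fin 6) : ℕ) = 0 ∧ ((1 : Fin 6) : ℕ) = 1 ∧ ((2 : Fin 6) : ℕ) = 2 ∧
    ((3 : Fin 6) : ℕ) = 3 ∧ ((4 : Fin 6) : ℕ) = 4 ∧ ((5 : Fin 6) : ℕ) = 5 := by decide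

/-- Out-neighbours of a variable connector `cx j`: the two heads of variable `j` (if `j < n`) or
`ce 0` (if `j = n`). [folklore] -/
theorem arc_cx_out {j : Fin (n + 1)} {w : Vtx n m} (h : Arc vr b (cx j) w) :
    (∃ v a, w = hd v a ∧ j = v.castSucc) ∨ (w = ce 0 ∧ j = Fin.last n) := by
  cases w <;> simp only [Arc] at h
  · exact Or.inr ⟨by rw [h.2], h.1⟩
  · exact Or.inl ⟨_, _, rfl, h⟩

/-- In-neighbours of a head `hd v a`: `cx v`, the `λ` of the first slot of `v`, or `tl v a` when `v`
does not occur. [folklore] -/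
theorem arc_hd_in {v : Fin n} {a : ZMod 2} {w : Vtx n m} (h : Arc vr b w (hd v a)) :
    w = cx v.castSucc ∨ (∃ o, w = nd a o 0 ∧ var vr o = v ∧ IsFirst vr o) ∨
      (w = tl v a ∧ ¬ Occurs vr v) := by
  cases w <;> simp only [Arc] at h
  · exact Or.inl (by rw [h])
  · obtain ⟨rfl, rfl, ho⟩ := h; exact Or.inr (Or.inr ⟨rfl, ho⟩)
  · obtain ⟨rfl, rfl, hv, hf⟩ := h; exact Or.inr (Or.inl ⟨_, rfl, hv, hf⟩)

/-- Out-neighbours of a head `hd v a`: `cx (v+1)`, the `λ` of the first slot of `v`, or `tl v a` when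
`v` does not occur. [folklore] -/
theorem arc_hd_out {v : Fin n} {a : ZMod 2} {w : Vtx n m} (h : Arc vr b (hd v a) w) :
    w = cx v.succ ∨ (∃ o, w = nd a o 0 ∧ var vr o = v ∧ IsFirst vr o) ∨
      (w = tl v a ∧ ¬ Occurs vr v) := by
  cases w <;> simp only [Arc] at h
  · exact Or.inl (by rw [h])
  · obtain ⟨rfl, rfl, ho⟩ := h; exact Or.inr (Or.inr ⟨rfl, ho⟩)
  · obtain ⟨rfl, rfl, hv, hf⟩ := h; exact Or.inr (Or.inl ⟨_, rfl, hv, hf⟩)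

/-- In-neighbours of a segment vertex, by kind of the source. [folklore] -/
theorem arc_nd_in {a : ZMod 2} {o : Occ m} {s : Fin 6} {w : Vtx n m} (h : Arc vr b w (nd a o s)) :
    (w = hd (var vr o) a ∧ s = 0 ∧ IsFirst vr o) ∨
    (w = tl (var vr o) a ∧ s = 5 ∧ IsLast vr o) ∨
    (∃ o' s', w = nd a o' s' ∧ ((o' = o ∧ ((s' : ℕ) + 1 = s ∨ (s : ℕ) + 1 = s')) ∨
      (s' = 5 ∧ s = 0 ∧ IsNextOcc vr o' o) ∨ (s' = 0 ∧ s = 5 ∧ IsNextOcc vr o o'))) ∨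
    (∃ u i t t', w = bm u i t t' ∧ s = 3 ∧ o.1 = u ∧ o.2.1 = i ∧ t' = t + 1 + a) := by
  cases w with
  | cx j => simp only [Arc] at h
  | ce j => simp only [Arc] at h
  | hd v a' =>
    simp only [Arc] at h
    obtain ⟨rfl, hs, hv, hf⟩ := h
    exact Or.inl ⟨by rw [hv], hs, hf⟩
  | tl v a' =>
    simp only [Arc] at h
    obtain ⟨rfl, hs, hv, hl⟩ := h
    exact Or.inr (Or.inl ⟨by rw [hv], hs, hl⟩)
  | nd a' o' s' =>
    simp only [Arc] at h
    obtain ⟨rfl, h⟩ := h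
    exact Or.inr (Or.inr (Or.inl ⟨o', s', rfl, h⟩))
  | bx u ℓ t => simp only [Arc] at h
  | bm u i t t' =>
    simp only [Arc] at h
    exact Or.inr (Or.inr (Or.inr ⟨u, i, t, t', rfl, h⟩))

/-- Out-neighbours of a segment vertex, by kind of the target. [folklore] -/
theorem arc_nd_out {a : ZMod 2} {o : Occ m} {s : Fin 6} {w : Vtx n m} (h : Arc vr b (nd a o s) w) :
    (w = hd (var vr o) a ∧ s = 0 ∧ IsFirst vr o) ∨
    (w = tl (var vr o) a ∧ s = 5 ∧ IsLast vr o) ∨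
    (∃ o' s', w = nd a o' s' ∧ ((o = o' ∧ ((s : ℕ) + 1 = s' ∨ (s' : ℕ) + 1 = s)) ∨
      (s = 5 ∧ s' = 0 ∧ IsNextOcc vr o o') ∨ (s = 0 ∧ s' = 5 ∧ IsNextOcc vr o' o))) ∨
    (∃ u i t t', w = bm u i t t' ∧ s = 2 ∧ o.1 = u ∧ o.2.1 = i ∧ t' = t + 1 + a) := by
  cases w with
  | cx j => simp only [Arc] at h
  | ce j => simp only [Arc] at h
  | hd v a' =>
    simp only [Arc] at h
    obtain ⟨rfl, hs, hv, hf⟩ := h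
    exact Or.inl ⟨by rw [hv], hs, hf⟩
  | tl v a' =>
    simp only [Arc] at h
    obtain ⟨rfl, hs, hv, hl⟩ := h
    exact Or.inr (Or.inl ⟨by rw [hv], hs, hl⟩)
  | nd a' o' s' =>
    simp only [Arc] at h
    obtain ⟨rfl, h⟩ := h
    exact Or.inr (Or.inr (Or.inl ⟨o', s', rfl, h⟩))
  | bx u ℓ t => simp only [Arc] at h
  | bm u i t t' =>
    simp only [Arc] at h
    exact Or.inr (Or.inr (Or.inr ⟨u, i, t, t', rfl, h⟩))

/-- In-neighbours of `α = nd a o 1`: `λ` and `p` of the same segment. [folklore] -/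
theorem arc_alpha_in {a : ZMod 2} {o : Occ m} {w : Vtx n m} (h : Arc vr b w (nd a o 1)) :
    w = nd a o 0 ∨ w = nd a o 2 := by
  rcases arc_nd_in h with ⟨-, hs, -⟩ | ⟨-, hs, -⟩ | ⟨o', s', rfl, hh⟩ | ⟨u, i, t, t', -, hs, -⟩
  · exact absurd hs (by decide)
  · exact absurd hs (by decide)
  · rcases hh with ⟨rfl, hs⟩ | ⟨-, hs, -⟩ | ⟨-, hs, -⟩
    · rw [val_fin6.2.1] at hs
      rcases Nat.lt_or_ge (s' : ℕ) 1 with h1 | h1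
      · left; rw [fin6_eq_of_val (by norm_num) (show (s' : ℕ) = 0 by omega)]; rfl
      · right; rw [fin6_eq_of_val (by norm_num) (show (s' : ℕ) = 2 by omega)]; rfl
    · exact absurd hs (by decide)
    · exact absurd hs (by decide)
  · exact absurd hs (by decide)

/-- Out-neighbours of `α = nd a o 1`: `λ` and `p`. [folklore] -/
theorem arc_alpha_out {a : ZMod 2} {o : Occ m} {w : Vtx n m} (h : Arc vr b (nd a o 1) w) :
    w = nd a o 0 ∨ w = nd a o 2 := by
  rcases arc_nd_out h with ⟨-, hs, -⟩ | ⟨-, hs, -⟩ | ⟨o', s', rfl, hh⟩ | ⟨u, i, t, t', -, hs, -⟩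
  · exact absurd hs (by decide)
  · exact absurd hs (by decide)
  · rcases hh with ⟨rfl, hs⟩ | ⟨hs, -, -⟩ | ⟨hs, -, -⟩
    · rw [val_fin6.2.1] at hs
      rcases Nat.lt_or_ge (s' : ℕ) 1 with h1 | h1
      · left; rw [fin6_eq_of_val (by norm_num) (show (s' : ℕ) = 0 by omega)]; rfl
      · right; rw [fin6_eq_of_val (by norm_num) (show (s' : ℕ) = 2 by omega)]; rfl
    · exact absurd hs (by decide)
    · exact absurd hs (by decide)
  · exact absurd hs (by decide)

/-- In-neighbours of `β = nd a o 4`: `q` and `ρ`. [folklore] -/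
theorem arc_beta_in {a : ZMod 2} {o : Occ m} {w : Vtx n m} (h : Arc vr b w (nd a o 4)) :
    w = nd a o 3 ∨ w = nd a o 5 := by
  rcases arc_nd_in h with ⟨-, hs, -⟩ | ⟨-, hs, -⟩ | ⟨o', s', rfl, hh⟩ | ⟨u, i, t, t', -, hs, -⟩
  · exact absurd hs (by decide)
  · exact absurd hs (by decide)
  · rcases hh with ⟨rfl, hs⟩ | ⟨-, hs, -⟩ | ⟨-, hs, -⟩
    · rw [val_fin6.2.2.2.2.1] at hs
      have := s'.2
      rcases Nat.lt_or_ge (s' : ℕ) 4 with h1 | h1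
      · left; rw [fin6_eq_of_val (by norm_num) (show (s' : ℕ) = 3 by omega)]; rfl
      · right; rw [fin6_eq_of_val (by norm_num) (show (s' : ℕ) = 5 by omega)]; rfl
    · exact absurd hs (by decide)
    · exact absurd hs (by decide)
  · exact absurd hs (by decide)

/-- Out-neighbours of `β = nd a o 4`: `q` and `ρ`. [folklore] -/
theorem arc_beta_out {a : ZMod 2} {o : Occ m} {w : Vtx n m} (h : Arc vr b (nd a o 4) w) :
    w = nd a o 3 ∨ w = nd a o 5 := by
  rcases arc_nd_out h with ⟨-, hs, -⟩ | ⟨-, hs, -⟩ | ⟨o', s', rfl, hh⟩ | ⟨u, i, t, t', -, hs, -⟩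
  · exact absurd hs (by decide)
  · exact absurd hs (by decide)
  · rcases hh with ⟨rfl, hs⟩ | ⟨hs, -, -⟩ | ⟨hs, -, -⟩
    · rw [val_fin6.2.2.2.2.1] at hs
      have := s'.2
      rcases Nat.lt_or_ge (s' : ℕ) 4 with h1 | h1
      · left; rw [fin6_eq_of_val (by norm_num) (show (s' : ℕ) = 3 by omega)]; rfl
      · right; rw [fin6_eq_of_val (by norm_num) (show (s' : ℕ) = 5 by omega)]; rfl
    · exact absurd hs (by decide)
    · exact absurd hs (by decide)
  · exact absurd hs (by decide)

/-- In-neighbours of `p = nd a o 2`: `α` and `q` only (links leave `p`). [folklore] -/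
theorem arc_p_in {a : ZMod 2} {o : Occ m} {w : Vtx n m} (h : Arc vr b w (nd a o 2)) :
    w = nd a o 1 ∨ w = nd a o 3 := by
  rcases arc_nd_in h with ⟨-, hs, -⟩ | ⟨-, hs, -⟩ | ⟨o', s', rfl, hh⟩ | ⟨u, i, t, t', -, hs, -⟩
  · exact absurd hs (by decide)
  · exact absurd hs (by decide)
  · rcases hh with ⟨rfl, hs⟩ | ⟨-, hs, -⟩ | ⟨-, hs, -⟩
    · rw [val_fin6.2.2.1] at hs
      rcases Nat.lt_or_ge (s' : ℕ) 2 with h1 | h1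
      · left; rw [fin6_eq_of_val (by norm_num) (show (s' : ℕ) = 1 by omega)]; rfl
      · right; rw [fin6_eq_of_val (by norm_num) (show (s' : ℕ) = 3 by omega)]; rfl
    · exact absurd hs (by decide)
    · exact absurd hs (by decide)
  · exact absurd hs (by decide)

/-- Out-neighbours of `p = nd a o 2`: `α`, `q`, or a block middle vertex `bm u i t (t+1+a)` of its own
constraint and position (a LINK). [folklore] -/
theorem arc_p_out {a : ZMod 2} {o : Occ m} {w : Vtx n m} (h : Arc vr b (nd a o 2) w) :
    w = nd a o 1 ∨ w = nd a o 3 ∨ ∃ t, w = bm o.1 o.2.1 t (t + 1 + a) := by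
  rcases arc_nd_out h with ⟨-, hs, -⟩ | ⟨-, hs, -⟩ | ⟨o', s', rfl, hh⟩ | ⟨u, i, t, t', rfl, -, hu, hi, ht⟩
  · exact absurd hs (by decide)
  · exact absurd hs (by decide)
  · rcases hh with ⟨rfl, hs⟩ | ⟨hs, -, -⟩ | ⟨hs, -, -⟩
    · rw [val_fin6.2.2.1] at hs
      rcases Nat.lt_or_ge (s' : ℕ) 2 with h1 | h1
      · left; rw [fin6_eq_of_val (by norm_num) (show (s' : ℕ) = 1 by omega)]; rfl
      · right; left; rw [fin6_eq_of_val (by norm_num) (show (s' : ℕ) = 3 by omega)]; rfl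
    · exact absurd hs (by decide)
    · exact absurd hs (by decide)
  · right; right; exact ⟨t, by rw [← hu, ← hi, ht]⟩

/-- In-neighbours of `q = nd a o 3`: `p`, `β`, or a block middle vertex `bm u i t (t+1+a)` of its own
constraint and position. [folklore] -/
theorem arc_q_in {a : ZMod 2} {o : Occ m} {w : Vtx n m} (h : Arc vr b w (nd a o 3)) :
    w = nd a o 2 ∨ w = nd a o 4 ∨ ∃ t, w = bm o.1 o.2.1 t (t + 1 + a) := by
  rcases arc_nd_in h with ⟨-, hs, -⟩ | ⟨-, hs, -⟩ | ⟨o', s', rfl, hh⟩ | ⟨u, i, t, t', rfl, -, hu, hi, ht⟩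
  · exact absurd hs (by decide)
  · exact absurd hs (by decide)
  · rcases hh with ⟨rfl, hs⟩ | ⟨-, hs, -⟩ | ⟨-, hs, -⟩
    · rw [val_fin6.2.2.2.1] at hs
      rcases Nat.lt_or_ge (s' : ℕ) 3 with h1 | h1
      · left; rw [fin6_eq_of_val (by norm_num) (show (s' : ℕ) = 2 by omega)]; rfl
      · right; left; rw [fin6_eq_of_val (by norm_num) (show (s' : ℕ) = 4 by omega)]; rfl
    · exact absurd hs (by decide)
    · exact absurd hs (by decide)
  · right; right; exact ⟨t, by rw [← hu, ← hi, ht]⟩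

/-- Out-neighbours of `q = nd a o 3`: `p` and `β` only (links enter `q`). [folklore] -/
theorem arc_q_out {a : ZMod 2} {o : Occ m} {w : Vtx n m} (h : Arc vr b (nd a o 3) w) :
    w = nd a o 2 ∨ w = nd a o 4 := by
  rcases arc_nd_out h with ⟨-, hs, -⟩ | ⟨-, hs, -⟩ | ⟨o', s', rfl, hh⟩ | ⟨u, i, t, t', -, hs, -⟩
  · exact absurd hs (by decide)
  · exact absurd hs (by decide)
  · rcases hh with ⟨rfl, hs⟩ | ⟨hs, -, -⟩ | ⟨hs, -, -⟩
    · rw [val_fin6.2.2.2.1] at hs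
      rcases Nat.lt_or_ge (s' : ℕ) 3 with h1 | h1
      · left; rw [fin6_eq_of_val (by norm_num) (show (s' : ℕ) = 2 by omega)]; rfl
      · right; rw [fin6_eq_of_val (by norm_num) (show (s' : ℕ) = 4 by omega)]; rfl
    · exact absurd hs (by decide)
    · exact absurd hs (by decide)
  · exact absurd hs (by decide)

/-- In-neighbours of `λ = nd a o 0`: `α`, the head (if `o` is first) or the `ρ` of the previous slot.
[folklore] -/
theorem arc_lam_in {a : ZMod 2} {o : Occ m} {w : Vtx n m} (h : Arc vr b w (nd a o 0)) :
    w = nd a o 1 ∨ (w = hd (var vr o) a ∧ IsFirst vr o) ∨ ∃ o', w = nd a o' 5 ∧ IsNextOcc vr o' o := by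
  rcases arc_nd_in h with ⟨hw, -, hf⟩ | ⟨-, hs, -⟩ | ⟨o', s', rfl, hh⟩ | ⟨u, i, t, t', -, hs, -⟩
  · exact Or.inr (Or.inl ⟨hw, hf⟩)
  · exact absurd hs (by decide)
  · rcases hh with ⟨rfl, hs⟩ | ⟨hs, -, hn⟩ | ⟨-, hs, -⟩
    · rw [val_fin6.1] at hs
      left; rw [fin6_eq_of_val (by norm_num) (show (s' : ℕ) = 1 by omega)]; rfl
    · right; right; exact ⟨o', by rw [hs], hn⟩
    · exact absurd hs (by decide)
  · exact absurd hs (by decide)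

/-- Out-neighbours of `λ = nd a o 0`: `α`, the head (if `o` is first) or the `ρ` of the previous slot.
[folklore] -/
theorem arc_lam_out {a : ZMod 2} {o : Occ m} {w : Vtx n m} (h : Arc vr b (nd a o 0) w) :
    w = nd a o 1 ∨ (w = hd (var vr o) a ∧ IsFirst vr o) ∨ ∃ o', w = nd a o' 5 ∧ IsNextOcc vr o' o := by
  rcases arc_nd_out h with ⟨hw, -, hf⟩ | ⟨-, hs, -⟩ | ⟨o', s', rfl, hh⟩ | ⟨u, i, t, t', -, hs, -⟩
  · exact Or.inr (Or.inl ⟨hw, hf⟩)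
  · exact absurd hs (by decide)
  · rcases hh with ⟨rfl, hs⟩ | ⟨hs, -, -⟩ | ⟨-, hs, hn⟩
    · rw [val_fin6.1] at hs
      left; rw [fin6_eq_of_val (by norm_num) (show (s' : ℕ) = 1 by omega)]; rfl
    · exact absurd hs (by decide)
    · right; right; exact ⟨o', by rw [hs], hn⟩
  · exact absurd hs (by decide)

/-- In-neighbours of `ρ = nd a o 5`: `β`, the tail (if `o` is last) or the `λ` of the next slot.
[folklore] -/
theorem arc_rho_in {a : ZMod 2} {o : Occ m} {w : Vtx n m} (h : Arc vr b w (nd a o 5)) :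
    w = nd a o 4 ∨ (w = tl (var vr o) a ∧ IsLast vr o) ∨ ∃ o', w = nd a o' 0 ∧ IsNextOcc vr o o' := by
  rcases arc_nd_in h with ⟨-, hs, -⟩ | ⟨hw, -, hl⟩ | ⟨o', s', rfl, hh⟩ | ⟨u, i, t, t', -, hs, -⟩
  · exact absurd hs (by decide)
  · exact Or.inr (Or.inl ⟨hw, hl⟩)
  · rcases hh with ⟨rfl, hs⟩ | ⟨-, hs, -⟩ | ⟨hs, -, hn⟩
    · rw [val_fin6.2.2.2.2.2] at hs
      have := s'.2
      left; rw [fin6_eq_of_val (by norm_num) (show (s' : ℕ) = 4 by omega)]; rfl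
    · exact absurd hs (by decide)
    · right; right; exact ⟨o', by rw [hs], hn⟩
  · exact absurd hs (by decide)

/-- Out-neighbours of `ρ = nd a o 5`: `β`, the tail (if `o` is last) or the `λ` of the next slot.
[folklore] -/
theorem arc_rho_out {a : ZMod 2} {o : Occ m} {w : Vtx n m} (h : Arc vr b (nd a o 5) w) :
    w = nd a o 4 ∨ (w = tl (var vr o) a ∧ IsLast vr o) ∨ ∃ o', w = nd a o' 0 ∧ IsNextOcc vr o o' := by
  rcases arc_nd_out h with ⟨-, hs, -⟩ | ⟨hw, -, hl⟩ | ⟨o', s', rfl, hh⟩ | ⟨u, i, t, t', -, hs, -⟩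
  · exact absurd hs (by decide)
  · exact Or.inr (Or.inl ⟨hw, hl⟩)
  · rcases hh with ⟨rfl, hs⟩ | ⟨-, hs, hn⟩ | ⟨hs, -, -⟩
    · rw [val_fin6.2.2.2.2.2] at hs
      have := s'.2
      left; rw [fin6_eq_of_val (by norm_num) (show (s' : ℕ) = 4 by omega)]; rfl
    · right; right; exact ⟨o', by rw [hs], hn⟩
    · exact absurd hs (by decide)
  · exact absurd hs (by decide)

/-- In-neighbours of a block middle vertex `bm u i t t'`: `bx u i t` and the `p`'s of the links of copy
`a` with `t' = t + 1 + a` at `(u, i)`. [folklore] -/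
theorem arc_bm_in {u : Fin m} {i : Fin 3} {t t' : ZMod 2} {w : Vtx n m} (h : Arc vr b w (bm u i t t')) :
    w = bx u i.castSucc t ∨ ∃ a o, w = nd a o 2 ∧ o.1 = u ∧ o.2.1 = i ∧ t' = t + 1 + a := by
  cases w with
  | cx j => simp only [Arc] at h
  | ce j => simp only [Arc] at h
  | hd v a' => simp only [Arc] at h
  | tl v a' => simp only [Arc] at h
  | nd a' o' s' =>
    simp only [Arc] at h
    obtain ⟨rfl, hu, hi, ht⟩ := h
    exact Or.inr ⟨a', o', rfl, hu, hi, ht⟩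
  | bx u' ℓ s =>
    simp only [Arc] at h
    obtain ⟨rfl, rfl, rfl⟩ := h
    exact Or.inl rfl
  | bm u' i' r r' => simp only [Arc] at h

/-- Out-neighbours of `bm u i t t'`: `bx u (i+1) t'` and the `q`'s of the links of copy `a` with
`t' = t + 1 + a` at `(u, i)`. [folklore] -/
theorem arc_bm_out {u : Fin m} {i : Fin 3} {t t' : ZMod 2} {w : Vtx n m} (h : Arc vr b (bm u i t t') w) :
    w = bx u i.succ t' ∨ ∃ a o, w = nd a o 3 ∧ o.1 = u ∧ o.2.1 = i ∧ t' = t + 1 + a := by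
  cases w with
  | cx j => simp only [Arc] at h
  | ce j => simp only [Arc] at h
  | hd v a' => simp only [Arc] at h
  | tl v a' => simp only [Arc] at h
  | nd a' o' s' =>
    simp only [Arc] at h
    obtain ⟨rfl, hu, hi, ht⟩ := h
    exact Or.inr ⟨a', o', rfl, hu, hi, ht⟩
  | bx u' ℓ s =>
    simp only [Arc] at h
    obtain ⟨rfl, rfl, rfl⟩ := h
    exact Or.inl rfl
  | bm u' i' r r' => simp only [Arc] at h

/-- Out-neighbours of `bx u i t` at a switch level `i < 3`: the two middle vertices `bm u i t t'`.
[folklore] -/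
theorem arc_bx_castSucc_out {u : Fin m} {i : Fin 3} {t : ZMod 2} {w : Vtx n m}
    (h : Arc vr b (bx u i.castSucc t) w) : ∃ t', w = bm u i t t' := by
  cases w with
  | cx j => simp only [Arc] at h
  | ce j =>
    simp only [Arc] at h
    exact absurd h.1 (Fin.ne_of_lt (Fin.castSucc_lt_last i))
  | hd v a' => simp only [Arc] at h
  | tl v a' => simp only [Arc] at h
  | nd a' o' s' => simp only [Arc] at h
  | bx u' ℓ s =>
    simp only [Arc] at h
    exact absurd h.2.1 (Fin.ne_of_lt (Fin.castSucc_lt_last i))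
  | bm u' i' r r' =>
    simp only [Arc] at h
    obtain ⟨rfl, hi, rfl⟩ := h
    rw [Fin.castSucc_inj.1 hi]
    exact ⟨r', rfl⟩

/-- Out-neighbours of the last level `bx u 3 s`: `bx u 0 1` if `s = b u`, `ce (u+1)` if
`s = b u + 1`. [folklore] -/
theorem arc_bx_three_out {u : Fin m} {s : ZMod 2} {w : Vtx n m} (h : Arc vr b (bx u 3 s) w) :
    (w = bx u 0 1 ∧ s = b u) ∨ (w = ce u.succ ∧ s = b u + 1) := by
  cases w with
  | cx j => simp only [Arc] at h
  | ce j =>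
    simp only [Arc] at h
    exact Or.inr ⟨by rw [h.2.2], h.2.1⟩
  | hd v a' => simp only [Arc] at h
  | tl v a' => simp only [Arc] at h
  | nd a' o' s' => simp only [Arc] at h
  | bx u' ℓ s' =>
    simp only [Arc] at h
    obtain ⟨rfl, -, hs, rfl, rfl⟩ := h
    exact Or.inl ⟨rfl, hs⟩
  | bm u' i' r r' =>
    simp only [Arc] at h
    exact absurd h.2.1.symm (Fin.ne_of_lt (Fin.castSucc_lt_last i'))

/-- In-neighbours of the entry level `bx u 0 s`: `ce u` if `s = 0`, `bx u 3 (b u)` if `s = 1`.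
[folklore] -/
theorem arc_bx_zero_in {u : Fin m} {s : ZMod 2} {w : Vtx n m} (h : Arc vr b w (bx u 0 s)) :
    (w = ce u.castSucc ∧ s = 0) ∨ (w = bx u 3 (b u) ∧ s = 1) := by
  cases w with
  | cx j => simp only [Arc] at h
  | ce j =>
    simp only [Arc] at h
    exact Or.inl ⟨by rw [h.1], h.2.2⟩
  | hd v a' => simp only [Arc] at h
  | tl v a' => simp only [Arc] at h
  | nd a' o' s' => simp only [Arc] at h
  | bx u' ℓ s' =>
    simp only [Arc] at h
    obtain ⟨rfl, rfl, rfl, -, hs⟩ := h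
    exact Or.inr ⟨rfl, hs⟩
  | bm u' i' r r' =>
    simp only [Arc] at h
    exact absurd h.2.1.symm (Fin.succ_ne_zero i')

/-- In-neighbours of a level `bx u (i+1) s` after a switch: the middle vertices `bm u i t s`.
[folklore] -/
theorem arc_bx_succ_in {u : Fin m} {i : Fin 3} {s : ZMod 2} {w : Vtx n m}
    (h : Arc vr b w (bx u i.succ s)) : ∃ t, w = bm u i t s := by
  cases w with
  | cx j => simp only [Arc] at h
  | ce j =>
    simp only [Arc] at h
    exact absurd h.2.1 (Fin.succ_ne_zero i)
  | hd v a' => simp only [Arc] at h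
  | tl v a' => simp only [Arc] at h
  | nd a' o' s' => simp only [Arc] at h
  | bx u' ℓ s' =>
    simp only [Arc] at h
    exact absurd h.2.2.2.1 (Fin.succ_ne_zero i)
  | bm u' i' r r' =>
    simp only [Arc] at h
    obtain ⟨rfl, hi, rfl⟩ := h
    rw [Fin.succ_inj.1 hi]
    exact ⟨r, rfl⟩

end Nbhd

/-! ### Reading order: first slots and next slots -/

section Order

variable {vr}

/-- Two first slots of the same variable coincide. [folklore] -/
theorem IsFirst.eq {o o' : Occ m} (ho : IsFirst vr o) (ho' : IsFirst vr o') (hv : var vr o = var vr o') :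
    o = o' :=
  flat_inj.1 (le_antisymm (ho o' hv.symm) (ho' o hv))

/-- The next slot is not first. [folklore] -/
theorem IsNextOcc.not_isFirst {o o' : Occ m} (hn : IsNextOcc vr o o') : ¬ IsFirst vr o' := fun hf => by
  have := hf o hn.1.symm
  have := hn.2.1
  omega

/-- A slot with a next slot is not last. [folklore] -/
theorem IsNextOcc.not_isLast {o o' : Occ m} (hn : IsNextOcc vr o o') : ¬ IsLast vr o := fun hl => by
  have := hl o' hn.1
  have := hn.2.1
  omega

/-- The next slot is unique. [folklore] -/
theorem IsNextOcc.unique_right {o o₁ o₂ : Occ m} (h₁ : IsNextOcc vr o o₁) (h₂ : IsNextOcc vr o o₂) :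
    o₁ = o₂ :=
  flat_inj.1 (le_antisymm (h₁.2.2 o₂ h₂.1 h₂.2.1) (h₂.2.2 o₁ h₁.1 h₁.2.1))

/-- The previous slot is unique. [folklore] -/
theorem IsNextOcc.unique_left {o o₁ o₂ : Occ m} (h₁ : IsNextOcc vr o₁ o) (h₂ : IsNextOcc vr o₂ o) :
    o₁ = o₂ := by
  by_contra hne
  have hv : var vr o₂ = var vr o₁ := h₂.1.symm.trans h₁.1
  rcases Nat.lt_or_ge (flat o₁) (flat o₂) with hlt | hge
  · have := h₁.2.2 o₂ hv hlt
    have := h₂.2.1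
    omega
  · rcases Nat.lt_or_eq_of_le hge with hlt | heq
    · have := h₂.2.2 o₁ hv.symm hlt
      have := h₁.2.1
      omega
    · exact hne (flat_inj.1 heq.symm)

/-- A slot that is not first has a previous slot. [folklore] -/
theorem exists_isNextOcc_of_not_isFirst {o' : Occ m} (hnf : ¬ IsFirst vr o') :
    ∃ o, IsNextOcc vr o o' := by
  classical
  simp only [IsFirst, not_forall, not_le, exists_prop] at hnf
  obtain ⟨o₀, ho₀, hlt₀⟩ := hnf
  -- the latest earlier slot of the same variable
  let P : Occ m → Prop := fun o => var vr o = var vr o' ∧ flat o < flat o'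
  obtain ⟨o, ho, homax⟩ := Finset.exists_max_image (Finset.univ.filter P) flat
    ⟨o₀, Finset.mem_filter.2 ⟨Finset.mem_univ _, ho₀, hlt₀⟩⟩
  obtain ⟨hov, holt⟩ := (Finset.mem_filter.1 ho).2
  refine ⟨o, hov.symm, holt, fun o'' ho'' hlt => ?_⟩
  by_contra hle
  have : flat o'' ≤ flat o :=
    homax o'' (Finset.mem_filter.2 ⟨Finset.mem_univ _, ho''.trans hov, by omega⟩)
  omega

end Order

end XorHam

end Literature.Combinatorics.SimpleGraph
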